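import Summits.QuantumFields.YangMills.Theorems.BalabanUVNodesN15KingModelPotentialComplexLimitLetters
import Literature.MathematicalPhysics.QuantumFieldTheory.Balaban1983to89.B13RealSliceRateLetters

/-!
# N15 (NE2) King-model rung, PART 39 — THE LEAVES AT COMPLEX COUPLING: the (H3) two-spacing SUP-RATE of the dressed LEVELS survives off the real axis,
# and the socket's checklist (H1)(H2′)(H3) + ROOT holds at every complex coupling of the disc

Eleventh generation (g11) of the seat `pub-ymgap-dag-n15-d`, part 39 (on 33 `…PotentialComplexLimitLetters` and the Literature lemma
`B13RealSliceRateLetters.rate_of_realSlice` — the tower form of T-28.2, part 38).  Parts 32∕33 transported the ROOT of the unit layer (the covariances'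
η-rate, King (4.38)) to complex coupling; the node's socket `NE2KingTransplant` organises NE2 as five LEAVES — (H1) coercivity, (H2) Combes–Thomas
budgets, (H2′) locality of the levels, (H3) the one-step SUP-RATE `|Δ^{(k+1)} − Δ^{(k)}| ≤ ε r^k` of the LEVELS (King's Lemma 4.3 (4.18)), (H4) volume
sums — of which (H3) is «THE ONLY TWO-SPACING LEAF».  At complex coupling: (H1) is 28b's Re-coercivity `γ₀∕2`, (H2′) is 32's `kingLevelPotC_apply_decay`,
(H4) is real; this file supplies (H3):

* §1 ★★ `kingLevel_twoSpacing_complexRate` — for odd `L ≥ 3`, `a, m² > 0`, on King-admissible tori, in 10e's window: at every complex coupling of the disc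
  `‖z‖ < (r∕(1+r))·min(r_K∕w₀, 1)`, `‖Δ^{(k+2)}_{z·v}(b,b′) − Δ^{(k+1)}_{z·v}(b,b′)‖ ≤ E^{1−λ(r)}·M_E^{λ(r)}·(θ₂^{1−λ(r)})^{k+1}` (`θ₂ = L^{−1∕2}`, `E = θ̄a + 2c₁w₁ + 1`,
  `M_E = max(E, 2(a + 2a²∕m²))`) — 10e's real-slice leaf (H3) for the dressed tower `t·v` (`dressedLeaves_fullPert`) and 28d's level bound on the disc,
  through `rate_of_realSlice realStructureComplex` (BY NAME, part 38's Literature lemma);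
* §2 ★ `kingLevel_twoSpacing_letters` — at complex coupling the level difference obeys BOTH the sup-rate of §1 AND (H2′)'s locality (32
  `kingLevelPotC_apply_decay` at the two levels): `‖Δ^{(k+2)}_{z·v} − Δ^{(k+1)}_{z·v}‖(b,b′) ≤ min(E^{1−λ}M_E^{λ}ϑ₂^{k+1}, 2M_Δ·e^{−(1−λ)2κ′|b−b′|})` — the input
  pair of King's «min ≤ geometric mean» step (`King1986.sub_kernel_rate`) that turns a sup rate into a position-space rate at half the decay;
* §3 ★★★ `kingLeaves_complexCoupling` — THE SOCKET's CHECKLIST AT A COMPLEX COUPLING, one statement: for every `z` of the disc and every `k ≥ 1`,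
  (H1) `Re⟨x̄, (Δ^{(k)}_{z·v} + aL⁻²Q*Q)x⟩ ≥ (γ₀∕2)‖x‖₂²` (28b), (H2′) `‖Δ^{(k)}_{z·v}(b,b′)‖ ≤ M_Δ·e^{−(1−λ)2κ′|b−b′|}` (32), (H3) §1, and the ROOT
  `‖C^{(k+1)}_{z·v} − C^{(k)}_{z·v}‖(x,y) ≤ C^{1−λ}M^{λ}ϑ^k·e^{−(1−λ)(κ₂∕2)|x−y|}` (33).

References (method): two-constants theorem [Ransford1995, Thm. 4.3.7] via `B13RealSliceRateLetters` ∕ `B13RealSliceEntryLetters` ∕ `TwoConstantsDisc` (BY NAME);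
template [B9] Thm 3.4 p.400; King Lemma 4.3 (4.18) p.672, (4.33)–(4.35), Lemma 4.5 (4.38) p.674.

HONEST SCOPE.  King's A = 0 SCALAR model; real potential towers × one complex coupling; the complex leaves are stated entrywise at a FIXED `z` (the socket
`NE2KingTransplant` itself is real-valued and is not instantiated over ℂ); NOT Bałaban's `U′U`; NOT a node discharge; count-neutral.  No `sorry`.
-/

noncomputable section

open scoped BigOperators Matrix
open Filter Topology Metric Finset Complex

namespace Summit.QuantumFields.YangMills.BalabanUVNodes.N15.KingModel

open Literature.MathematicalPhysics.QuantumFieldTheory.Balaban1983to89 hiding blockOf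
open Literature.MathematicalPhysics.QuantumFieldTheory.Balaban1983to89.B5Prop11Plancherel (Tor fine)
open Literature.MathematicalPhysics.QuantumFieldTheory.Balaban1983to89.B5Prop11Lower (nsq)
open Literature.MathematicalPhysics.QuantumFieldTheory.Balaban1983to89.B13RealSliceEntryLetters (lam lam_nonneg lam_lt_one realStructureComplex)
open Literature.MathematicalPhysics.QuantumFieldTheory.Balaban1983to89.B13RealSliceRateLetters (rate_of_realSlice rpow_ratio_lt_one)
open Literature.MathematicalPhysics.QuantumFieldTheory.King1986 (aK aK_pos aK_le)
open Literature.MathematicalPhysics.QuantumFieldTheory.King1986.Torus (gam0L gam0L_pos tdistT tdistT_isPseudoDist kapCT kapCT_pos_le thetaBar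
  CDelU aminL)
open Summit.QuantumFields.BalabanUV.T4Continuum.NE2KingTransplant (IsPseudoMetric UniformCoercive UniformKernelDecay EffectiveOperatorSupRate)
open Summit.QuantumFields.YangMills.BalabanUVNodes.N15KingModelRung.Curved (underPtN)

variable {d : ℕ}

section KingU

variable (L : ℕ) [NeZero L]

/-! ## §1 (H3) at complex coupling: the two-spacing sup-rate of the dressed levels -/

/-- ★★ **(H3) AT COMPLEX COUPLING — THE ONE-STEP RATE OF THE DRESSED LEVELS SURVIVES OFF THE REAL AXIS.**  For odd `L ≥ 3`, `a, m² > 0` there are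
`w₁, E > 0` such that for every volume exponent, every potential tower of 10e's window (`sup|v_N| ≤ w₀ ≤ w₁`, `w₀ > 0`, coherence defect `≤ ν₀s^k`,
`0 ≤ ν₀ ≤ w₁`, `0 ≤ s ≤ L^{−1∕2}`), every `k`, every `0 < r < 1`, every complex coupling with `‖z‖ < (r∕(1+r))·min(r_K∕w₀, 1)` and all unit sites:
`‖Δ^{(k+2)}_{z·v}(b,b′) − Δ^{(k+1)}_{z·v}(b,b′)‖ ≤ E^{1−λ(r)}·M^{λ(r)}·(θ₂^{1−λ(r)})^{k+1}`, `θ₂ = L^{−1∕2}`, `M = max(E, 2(a + 2a²∕m²))` — 10e's leaf (H3) for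
the real towers `t·v` (`dressedLeaves_fullPert`, constant `θ̄a + c₁(w₀+ν₀) ≤ E := θ̄a + 2c₁w₁`), 28d's bound `a + 2a²∕m²` on the disc, 32's holomorphy of the
levels, through the Literature lemma `rate_of_realSlice realStructureComplex` (BY NAME).  (Levels indexed from `1`: the tower's level `j` is `Δ^{(max j 1)}`.)
[cite: King1986, Lemma 4.3 (4.18) p.672, (4.35) p.674 (A = 0 template); Balaban1985BackgroundPropagators, Thm 3.4 p.400; Ransford1995, Thm. 4.3.7] -/
theorem kingLevel_twoSpacing_complexRate (hLodd : Odd L) (hL : 2 ≤ L) {a m2 : ℝ} (ha : 0 < a) (hm : 0 < m2) :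
    ∃ w₁ E : ℝ, 0 < w₁ ∧ 0 < E ∧
      ∀ (e : ℕ) (v : ∀ N : ℕ, Tor (fine N (kingU d L e)) → ℝ) (w₀ ν₀ s : ℝ),
      0 ≤ ν₀ → ν₀ ≤ w₁ → 0 ≤ s → s ≤ (L : ℝ) ^ (-(1 / 2 : ℝ)) →
      0 < w₀ → (∀ (N : ℕ) (x : Tor (fine N (kingU d L e))), |v N x| ≤ w₀) → w₀ ≤ w₁ →
      (∀ (k : ℕ), 1 ≤ k → ∀ x' : Tor (fine (L ^ 1 * L ^ k) (kingU d L e)),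
          |v (L ^ 1 * L ^ k) x' - v (L ^ k) (underPtN L k 1 (kingU d L e) x')| ≤ ν₀ * s ^ k) →
      ∀ (b b' : Tor (kingU d L e)) (k : ℕ) (r : ℝ), 0 < r → r < 1 →
      ∀ z : ℂ, ‖z‖ < r / (1 + r) * min (cplxWindow d a m2 L / w₀) 1 →
        ‖kingLevelPotC d a m2 L (kingM d L e) (k + 2) z (v (L ^ (k + 2))) b b' - kingLevelPotC d a m2 L (kingM d L e) (k + 1) z (v (L ^ (k + 1))) b b'‖
          ≤ E ^ (1 - lam r) * (max E (2 * (a + 2 * a ^ 2 / m2))) ^ lam r * ((((L : ℝ) ^ (-(1 / 2 : ℝ))) ^ (1 - lam r)) ^ (k + 1)) := by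
  obtain ⟨κ, c₁, V, w₁, hκ, hc₁, hV, hw₁, -, HD⟩ := dressedLeaves_fullPert (d := d) L hLodd hL ha hm
  have hθb := thetaBar_mul_nonneg (a := a) ha hL
  set E : ℝ := thetaBar a L * a + c₁ * (w₁ + w₁) + 1 with hE
  have hE0 : 0 < E := by positivity
  refine ⟨w₁, E, hw₁, hE0, ?_⟩
  intro e v w₀ ν₀ s hν₀ hν₁ hs0 hs1 hw₀ hv hw₁' hcoh b b' k r hr0 hr1 z hz
  have hγ := gam0L_pos (d := d + 1) ha hL
  have hwin := cplxWindow_pos (d := d) (a := a) (m2 := m2) (L := L) ha hm hL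
  set θ₂ : ℝ := (L : ℝ) ^ (-(1 / 2 : ℝ)) with hθ₂
  have hθ0 : 0 ≤ θ₂ := Real.rpow_nonneg (Nat.cast_nonneg _) _
  have hθ1 : θ₂ ≤ 1 := by
    have hL1 : (1 : ℝ) ≤ L := by exact_mod_cast (by omega : 1 ≤ L)
    exact Real.rpow_le_one_of_one_le_of_nonpos hL1 (by norm_num)
  set R₁ : ℝ := min (cplxWindow d a m2 L / w₀) 1 with hR₁
  -- the family `K k ζ := Δ^{(k+2)}_{ζ·v} − Δ^{(k+1)}_{ζ·v}` as matrices
  set K : ℕ → ℂ → Matrix (Tor (kingU d L e)) (Tor (kingU d L e)) ℂ := fun k ζ =>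
    kingLevelPotC d a m2 L (kingM d L e) (k + 2) ζ (v (L ^ (k + 2))) - kingLevelPotC d a m2 L (kingM d L e) (k + 1) ζ (v (L ^ (k + 1))) with hK
  have hk1 : ∀ k : ℕ, 1 ≤ k + 1 := fun k => Nat.succ_le_succ (Nat.zero_le k)
  have hk2 : ∀ k : ℕ, 1 ≤ k + 2 := fun k => Nat.succ_le_succ (Nat.zero_le _)
  have hKd : ∀ k i j, DifferentiableOn ℂ (fun ζ => K k ζ i j) (ball (0 : ℂ) R₁) := fun k i j =>
    (differentiableOn_kingLevelPotC_ball (d := d) ha hm hL (hk2 k) hw₀ (hv _) i j).sub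
      (differentiableOn_kingLevelPotC_ball (d := d) ha hm hL (hk1 k) hw₀ (hv _) i j)
  have hKM : ∀ k, ∀ ζ ∈ ball (0 : ℂ) R₁, ∀ i j, ‖K k ζ i j‖ ≤ max E (2 * (a + 2 * a ^ 2 / m2)) := by
    intro k ζ hζ i j
    have hzw := norm_mul_le_cplxWindow_of_mem_ball (d := d) (a := a) (m2 := m2) (L := L) hw₀ hζ
    refine le_trans ?_ (le_max_right _ _)
    calc ‖K k ζ i j‖ ≤ ‖kingLevelPotC d a m2 L (kingM d L e) (k + 2) ζ (v (L ^ (k + 2))) i j‖ + ‖kingLevelPotC d a m2 L (kingM d L e) (k + 1) ζ (v (L ^ (k + 1))) i j‖ := by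
          simp only [hK, Matrix.sub_apply]; exact norm_sub_le _ _
      _ ≤ (a + 2 * a ^ 2 / m2) + (a + 2 * a ^ 2 / m2) :=
          add_le_add (norm_kingLevelPotC_apply_le (M := kingM d L e) ha hm hL (hk2 k) (hv _) hzw i j)
            (norm_kingLevelPotC_apply_le (M := kingM d L e) ha hm hL (hk1 k) (hv _) hzw i j)
      _ = 2 * (a + 2 * a ^ 2 / m2) := by ring
  -- the real-slice leaf (H3) on the tower t·v: rate θ₂, constant θ̄a + c₁(|t|w₀ + |t|ν₀) ≤ E; shift k ↦ k+1 costs one factor θ₂ ≤ 1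
  have hKB : ∀ k, ∀ ζ ∈ realStructureComplex.Ereal, ‖ζ‖ < R₁ → ∀ i j,
      ‖K k ζ i j‖ ≤ (E * θ₂) * θ₂ ^ k * Real.exp (-(0 * tdistT (kingU d L e) i j)) := by
    intro k ζ hζ hζR i j
    obtain ⟨t, rfl, ht1⟩ := exists_real_of_mem_Ereal hζ (min_le_right _ _) hζR
    have hvt : ∀ (N : ℕ) (x : Tor (fine N (kingU d L e))), |(t • v) N x| ≤ |t| * w₀ := by
      intro N x'
      show |t * v N x'| ≤ |t| * w₀
      rw [abs_mul]
      exact mul_le_mul_of_nonneg_left (hv N x') (abs_nonneg t)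
    have hcoht : ∀ (k : ℕ), 1 ≤ k → ∀ x' : Tor (fine (L ^ 1 * L ^ k) (kingU d L e)),
        |(t • v) (L ^ 1 * L ^ k) x' - (t • v) (L ^ k) (underPtN L k 1 (kingU d L e) x')| ≤ (|t| * ν₀) * s ^ k := by
      intro k hk x'
      show |t * v (L ^ 1 * L ^ k) x' - t * v (L ^ k) (underPtN L k 1 (kingU d L e) x')| ≤ (|t| * ν₀) * s ^ k
      rw [← mul_sub, abs_mul, mul_assoc]
      exact mul_le_mul_of_nonneg_left (hcoh k hk x') (abs_nonneg t)
    have htw : |t| * w₀ ≤ w₁ := by nlinarith [abs_nonneg t]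
    have htν : |t| * ν₀ ≤ w₁ := by nlinarith [abs_nonneg t]
    obtain ⟨-, -, -, g3, -⟩ := HD e (t • v) (|t| * w₀) (|t| * ν₀) s (by positivity) htν hs0 hs1 hvt htw hcoht
    have hr3 := g3 (k + 1) i j
    -- read the level difference over ℂ at the real coupling
    have e1 : K k (t : ℂ) i j = ((((kingTower a m2 L (kingM d L e) + fullPert a m2 L (kingM d L e) (t • v)) (k + 1 + 1)
        - (kingTower a m2 L (kingM d L e) + fullPert a m2 L (kingM d L e) (t • v)) (k + 1)) i j : ℝ) : ℂ) := by
      simp only [hK, Matrix.sub_apply, kingTower_add_fullPert]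
      rw [kingLevelPotC_real_eq_kingTowerPot v (hk2 k) t i j, kingLevelPotC_real_eq_kingTowerPot v (hk1 k) t i j]
      push_cast
      rfl
    rw [e1, Complex.norm_real, Real.norm_eq_abs, zero_mul, neg_zero, Real.exp_zero, mul_one]
    refine hr3.trans ?_
    have hst : s ^ (k + 1) ≤ θ₂ ^ (k + 1) := pow_le_pow_left₀ hs0 hs1 _
    have hcoef : thetaBar a L * a + c₁ * (|t| * w₀ + |t| * ν₀) ≤ E := by
      have : c₁ * (|t| * w₀ + |t| * ν₀) ≤ c₁ * (w₁ + w₁) := mul_le_mul_of_nonneg_left (by linarith) hc₁.le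
      linarith
    calc (thetaBar a L * a + c₁ * (|t| * w₀ + |t| * ν₀)) * ((L : ℝ) ^ (-(1 / 2 : ℝ))) ^ (k + 1)
        ≤ E * θ₂ ^ (k + 1) := mul_le_mul hcoef le_rfl (pow_nonneg hθ0 _) hE0.le
      _ = (E * θ₂) * θ₂ ^ k := by rw [pow_succ]; ring
  have hdist : ∀ i j : Tor (kingU d L e), 0 ≤ tdistT (kingU d L e) i j := (tdistT_isPseudoDist (kingU d L e)).nonneg
  have hB0 : 0 ≤ E * θ₂ := by positivity
  have hBM : E * θ₂ ≤ max E (2 * (a + 2 * a ^ 2 / m2)) := (mul_le_of_le_one_right hE0.le hθ1).trans (le_max_left _ _)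
  have key := rate_of_realSlice realStructureComplex hKd hKM hKB hB0 hBM hθ0 hθ1 le_rfl hdist hr0 hr1 z (by rwa [mem_ball_zero_iff]) k b b'
  rw [mul_zero, zero_mul, neg_zero, Real.exp_zero, mul_one] at key
  -- `(E θ₂)^{1−λ} M^λ (θ₂^{1−λ})^k = E^{1−λ} M^λ (θ₂^{1−λ})^{k+1}`
  have hEθ : (E * θ₂) ^ (1 - lam r) = E ^ (1 - lam r) * θ₂ ^ (1 - lam r) := Real.mul_rpow hE0.le hθ0
  calc ‖kingLevelPotC d a m2 L (kingM d L e) (k + 2) z (v (L ^ (k + 2))) b b' - kingLevelPotC d a m2 L (kingM d L e) (k + 1) z (v (L ^ (k + 1))) b b'‖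
      = ‖K k z b b'‖ := by simp only [hK, Matrix.sub_apply]
    _ ≤ (E * θ₂) ^ (1 - lam r) * (max E (2 * (a + 2 * a ^ 2 / m2))) ^ lam r * (θ₂ ^ (1 - lam r)) ^ k := key
    _ = E ^ (1 - lam r) * (max E (2 * (a + 2 * a ^ 2 / m2))) ^ lam r * (θ₂ ^ (1 - lam r)) ^ (k + 1) := by rw [hEθ, pow_succ]; ring

/-! ## §2 Both letters of the level difference at complex coupling -/

/-- ★ **THE LEVEL DIFFERENCE AT COMPLEX COUPLING: SUP-RATE AND LOCALITY TOGETHER** (the input pair of King's «min ≤ geometric mean» step).  For odd `L ≥ 3`,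
`a, m² > 0` there are `w₁, E > 0` such that for every potential tower of the window (`sup|v_N| ≤ w₀ ≤ w₁`, here `w₁ ≤ w̄` too), every `k`, `0 < r < 1`,
every `z` of the disc `‖z‖ < (r∕(1+r))·min(r_K∕w₀, 1)` and all unit sites:
`‖Δ^{(k+2)}_{z·v}(b,b′) − Δ^{(k+1)}_{z·v}(b,b′)‖ ≤ min( E^{1−λ}·M_E^{λ}·(θ₂^{1−λ})^{k+1} , 2M_Δ·e^{−(1−λ(r))·2κ′·|b−b′|_T} )`,
`M_E = max(E, 2(a+2a²∕m²))`, `M_Δ = max(a + a²ctCK, a + 2a²∕m²)` (§1 and 32's `kingLevelPotC_apply_decay` at the levels `k+2`, `k+1`).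
[cite: King1986, Lemma 4.3 (4.18) p.672, (4.34)–(4.35) p.674 (A = 0 template); Balaban1985BackgroundPropagators, Thm 3.4 p.400; Ransford1995, Thm. 4.3.7] -/
theorem kingLevel_twoSpacing_letters (hLodd : Odd L) (hL : 2 ≤ L) {a m2 : ℝ} (ha : 0 < a) (hm : 0 < m2) :
    ∃ w₁ E : ℝ, 0 < w₁ ∧ 0 < E ∧
      ∀ (e : ℕ) (v : ∀ N : ℕ, Tor (fine N (kingU d L e)) → ℝ) (w₀ ν₀ s : ℝ),
      0 ≤ ν₀ → ν₀ ≤ w₁ → 0 ≤ s → s ≤ (L : ℝ) ^ (-(1 / 2 : ℝ)) →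
      0 < w₀ → (∀ (N : ℕ) (x : Tor (fine N (kingU d L e))), |v N x| ≤ w₀) → w₀ ≤ w₁ →
      (∀ (k : ℕ), 1 ≤ k → ∀ x' : Tor (fine (L ^ 1 * L ^ k) (kingU d L e)),
          |v (L ^ 1 * L ^ k) x' - v (L ^ k) (underPtN L k 1 (kingU d L e) x')| ≤ ν₀ * s ^ k) →
      ∀ (b b' : Tor (kingU d L e)) (k : ℕ) (r : ℝ), 0 < r → r < 1 →
      ∀ z : ℂ, ‖z‖ < r / (1 + r) * min (cplxWindow d a m2 L / w₀) 1 →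
        ‖kingLevelPotC d a m2 L (kingM d L e) (k + 2) z (v (L ^ (k + 2))) b b' - kingLevelPotC d a m2 L (kingM d L e) (k + 1) z (v (L ^ (k + 1))) b b'‖
          ≤ min (E ^ (1 - lam r) * (max E (2 * (a + 2 * a ^ 2 / m2))) ^ lam r * ((((L : ℝ) ^ (-(1 / 2 : ℝ))) ^ (1 - lam r)) ^ (k + 1)))
              (2 * max (a + a ^ 2 * ctCK (d + 1) a L) (a + 2 * a ^ 2 / m2)
                * Real.exp (-((1 - lam r) * (2 * kapCT (d + 1) a L) * tdistT (kingU d L e) b b'))) := by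
  obtain ⟨w₁, E, hw₁, hE, H⟩ := kingLevel_twoSpacing_complexRate (d := d) L hLodd hL ha hm
  have hwb := (dressedConsts_nonneg (d := d) (a := a) (L := L) ha hL).2.2
  refine ⟨min w₁ (wbarK (d + 1) a L), E, lt_min hw₁ hwb, hE, ?_⟩
  intro e v w₀ ν₀ s hν₀ hν₁ hs0 hs1 hw₀ hv hw₁' hcoh b b' k r hr0 hr1 z hz
  have hν1 : ν₀ ≤ w₁ := hν₁.trans (min_le_left _ _)
  have hwa : w₀ ≤ w₁ := hw₁'.trans (min_le_left _ _)
  have hwbar : w₀ ≤ wbarK (d + 1) a L := hw₁'.trans (min_le_right _ _)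
  refine le_min (H e v w₀ ν₀ s hν₀ hν1 hs0 hs1 hw₀ hv hwa hcoh b b' k r hr0 hr1 z hz) ?_
  have hk1 : 1 ≤ k + 1 := Nat.succ_le_succ (Nat.zero_le k)
  have hk2 : 1 ≤ k + 2 := Nat.succ_le_succ (Nat.zero_le _)
  have h2 := kingLevelPotC_apply_decay (M := kingM d L e) (m2 := m2) ha hm hL hk2 hw₀ hwbar hv hr0 hr1 hz b b'
  have h1 := kingLevelPotC_apply_decay (M := kingM d L e) (m2 := m2) ha hm hL hk1 hw₀ hwbar hv hr0 hr1 hz b b'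
  calc ‖kingLevelPotC d a m2 L (kingM d L e) (k + 2) z (v (L ^ (k + 2))) b b' - kingLevelPotC d a m2 L (kingM d L e) (k + 1) z (v (L ^ (k + 1))) b b'‖
      ≤ ‖kingLevelPotC d a m2 L (kingM d L e) (k + 2) z (v (L ^ (k + 2))) b b'‖ + ‖kingLevelPotC d a m2 L (kingM d L e) (k + 1) z (v (L ^ (k + 1))) b b'‖ :=
        norm_sub_le _ _
    _ ≤ _ := by linarith [h1, h2]

/-! ## §3 The socket's checklist at a complex coupling -/

/-- ★★★ **THE LEAVES AND THE ROOT AT A COMPLEX COUPLING — (H1), (H2′), (H3) AND (4.38) FOR THE COMPLEX-DRESSED TOWER, ONE STATEMENT.**  For odd `L ≥ 3`,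
`a, m² > 0` there are `κ₂, w₁, C, E > 0` such that for every volume exponent, every potential tower of the window, every `0 < r < 1` and every complex
coupling `z` with `‖z‖ < (r∕(1+r))·min(r_K∕w₀, 1)` (`λ = λ(r)`, `θ = L^{−1∕4}`, `θ₂ = L^{−1∕2}`):
(H1) for every `k ≥ 1` and every `x`, `(γ₀∕2)·‖x‖₂² ≤ Re ⟨x̄, (Δ^{(k)}_{z·v} + aL⁻²Q*Q)x⟩` (28b `reCoercive_kingLevelPotC_add_block_window`);
(H2′) for every `k ≥ 1`, `‖Δ^{(k)}_{z·v}(b,b′)‖ ≤ max(a + a²ctCK, a + 2a²∕m²)·e^{−(1−λ)·2κ′·|b−b′|_T}` (32 `kingLevelPotC_apply_decay`);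
(H3) for every `k`, `‖Δ^{(k+2)}_{z·v} − Δ^{(k+1)}_{z·v}‖(b,b′) ≤ E^{1−λ}·max(E, 2(a+2a²∕m²))^{λ}·(θ₂^{1−λ})^{k+1}` (§1);
(ROOT) for every `k ≥ 1`, `‖C^{(k+1)}_{z·v} − C^{(k)}_{z·v}‖(x,y) ≤ C^{1−λ}·max(C, 4∕γ₀)^{λ}·(θ^{1−λ})^k·e^{−(1−λ)(κ₂∕2)|x−y|_T}` (32∕33).
[cite: King1986, (4.33)–(4.35) p.674, Lemma 4.3 (4.18) p.672, Lemma 4.5 (4.38) p.674 (A = 0 template); Balaban1985BackgroundPropagators, Thm 3.4 p.400; Ransford1995, Thm. 4.3.7] -/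
theorem kingLeaves_complexCoupling (hLodd : Odd L) (hL : 2 ≤ L) {a m2 : ℝ} (ha : 0 < a) (hm : 0 < m2) :
    ∃ κ₂ w₁ C E : ℝ, 0 < κ₂ ∧ 0 < w₁ ∧ 0 < C ∧ 0 < E ∧
      ∀ (e : ℕ) (v : ∀ N : ℕ, Tor (fine N (kingU d L e)) → ℝ) (w₀ ν₀ s : ℝ),
      0 ≤ ν₀ → ν₀ ≤ w₁ → 0 ≤ s → s ≤ (L : ℝ) ^ (-(1 / 2 : ℝ)) →
      0 < w₀ → (∀ (N : ℕ) (x : Tor (fine N (kingU d L e))), |v N x| ≤ w₀) → w₀ ≤ w₁ →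
      (∀ (k : ℕ), 1 ≤ k → ∀ x' : Tor (fine (L ^ 1 * L ^ k) (kingU d L e)),
          |v (L ^ 1 * L ^ k) x' - v (L ^ k) (underPtN L k 1 (kingU d L e) x')| ≤ ν₀ * s ^ k) →
      ∀ (r : ℝ), 0 < r → r < 1 → ∀ z : ℂ, ‖z‖ < r / (1 + r) * min (cplxWindow d a m2 L / w₀) 1 →
        (∀ k, 1 ≤ k → ∀ x : Tor (kingU d L e) → ℂ,
          (gam0L (d + 1) a L / 2) * nsq x
            ≤ (star x ⬝ᵥ (kingLevelPotC d a m2 L (kingM d L e) k z (v (L ^ k)) + (kingBlock a L (kingM d L e)).map Complex.ofReal) *ᵥ x).re) ∧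
        (∀ k, 1 ≤ k → ∀ b b' : Tor (kingU d L e),
          ‖kingLevelPotC d a m2 L (kingM d L e) k z (v (L ^ k)) b b'‖
            ≤ max (a + a ^ 2 * ctCK (d + 1) a L) (a + 2 * a ^ 2 / m2)
                * Real.exp (-((1 - lam r) * (2 * kapCT (d + 1) a L) * tdistT (kingU d L e) b b'))) ∧
        (∀ (k : ℕ) (b b' : Tor (kingU d L e)),
          ‖kingLevelPotC d a m2 L (kingM d L e) (k + 2) z (v (L ^ (k + 2))) b b' - kingLevelPotC d a m2 L (kingM d L e) (k + 1) z (v (L ^ (k + 1))) b b'‖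
            ≤ E ^ (1 - lam r) * (max E (2 * (a + 2 * a ^ 2 / m2))) ^ lam r * ((((L : ℝ) ^ (-(1 / 2 : ℝ))) ^ (1 - lam r)) ^ (k + 1))) ∧
        (∀ k, 1 ≤ k → ∀ x y : Tor (kingU d L e),
          ‖kingCovPotC d a m2 L (kingM d L e) (k + 1) z (v (L ^ (k + 1))) x y - kingCovPotC d a m2 L (kingM d L e) k z (v (L ^ k)) x y‖
            ≤ C ^ (1 - lam r) * (max C (4 / gam0L (d + 1) a L)) ^ lam r * ((((L : ℝ) ^ (-(1 / 4 : ℝ))) ^ (1 - lam r)) ^ k)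
                * Real.exp (-((1 - lam r) * (κ₂ / 2) * tdistT (kingU d L e) x y))) := by
  obtain ⟨w₁, E, hw₁, hE, H3⟩ := kingLevel_twoSpacing_complexRate (d := d) L hLodd hL ha hm
  obtain ⟨κ₂, w₂, C, hκ₂, hw₂, hC, HR⟩ := kingCov_twoSpacing_complexRate_geometric (d := d) L hLodd hL ha hm
  have hwb := (dressedConsts_nonneg (d := d) (a := a) (L := L) ha hL).2.2
  refine ⟨κ₂, min (min w₁ w₂) (wbarK (d + 1) a L), C, E, hκ₂, lt_min (lt_min hw₁ hw₂) hwb, hC, hE, ?_⟩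
  intro e v w₀ ν₀ s hν₀ hν₁ hs0 hs1 hw₀ hv hw₁' hcoh r hr0 hr1 z hz
  have hν1 : ν₀ ≤ w₁ := hν₁.trans ((min_le_left _ _).trans (min_le_left _ _))
  have hν2 : ν₀ ≤ w₂ := hν₁.trans ((min_le_left _ _).trans (min_le_right _ _))
  have hwa : w₀ ≤ w₁ := hw₁'.trans ((min_le_left _ _).trans (min_le_left _ _))
  have hwc : w₀ ≤ w₂ := hw₁'.trans ((min_le_left _ _).trans (min_le_right _ _))
  have hwbar : w₀ ≤ wbarK (d + 1) a L := hw₁'.trans (min_le_right _ _)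
  have hwin := cplxWindow_pos (d := d) (a := a) (m2 := m2) (L := L) ha hm hL
  obtain ⟨hrad, -⟩ := disc_radius_le (d := d) (a := a) (m2 := m2) L hr0 hw₀ hwin
  have hz1 : z ∈ ball (0 : ℂ) (min (cplxWindow d a m2 L / w₀) 1) := mem_ball_zero_iff.2 (lt_of_lt_of_le hz hrad)
  have hzw := norm_mul_le_cplxWindow_of_mem_ball (d := d) (a := a) (m2 := m2) (L := L) hw₀ hz1
  refine ⟨fun k hk x => reCoercive_kingLevelPotC_add_block_window (M := kingM d L e) ha hm hL hk hw₀.le (hv _) hzw x,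
    fun k hk b b' => kingLevelPotC_apply_decay (M := kingM d L e) (m2 := m2) ha hm hL hk hw₀ hwbar hv hr0 hr1 hz b b',
    fun k b b' => H3 e v w₀ ν₀ s hν₀ hν1 hs0 hs1 hw₀ hv hwa hcoh b b' k r hr0 hr1 z hz,
    fun k hk x y => HR e v w₀ ν₀ s hν₀ hν2 hs0 hs1 hw₀ hv hwc hcoh x y k hk r hr0 hr1 z hz⟩

end KingU

end Summit.QuantumFields.YangMills.BalabanUVNodes.N15.KingModel

end
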